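import Mathlib
import Summits.Ventures.PercRepro2.Defs
import Summits.Ventures.PercRepro2.Independence
import Summits.Ventures.PercRepro2.Harris
import Summits.Ventures.PercRepro2.Graph
import Summits.Ventures.PercRepro2.Exploration
import Summits.Ventures.PercRepro2.Events
import Summits.Ventures.PercRepro2.FourFunctions
import Summits.Ventures.PercRepro2.Induced
import Summits.Ventures.PercRepro2.Frontier
import Summits.Ventures.PercRepro2.ObsIndependence
import Summits.Ventures.PercRepro2.BHK
import Summits.Ventures.PercRepro2.BHKEvents
import Summits.Ventures.PercRepro2.OrderPreservation
import Summits.Ventures.PercRepro2.OrderPreservationDual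
import Summits.Ventures.PercRepro2.VdBKahn
import Summits.Ventures.PercRepro2.BHKAvoid
import Summits.Ventures.PercRepro2.R2PrimeThreeReduction
import Summits.Ventures.PercRepro2.YBridge
import Summits.Ventures.PercRepro2.Yu1Functionals
import Summits.Ventures.PercRepro2.Yu1Events

import Summits.Ventures.PercRepro2.Yu1

import Summits.Ventures.PercRepro2.LBSplit

import Summits.Ventures.PercRepro2.YDelta

/-!
# Companions of (L_A): `(L_A⁰)`, `(Tpart′)`, `(WtD)` — and `(WtD)` is a theorem
(blind cell PercRepro2, typer-1; `proofs/LEAD-PROOFSHAPES.md` §8.9 ADDENDUM 14 (1), (6), (8))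

Vocabulary of `YBridge` / `YDelta` (`a₁ = a_l`, `a₂ = a_h`): `R = avoidAll a₁ {a₂, a₃}`, `T`, `PD`,
`W = M₂ + Δ_T`, `R_b = R ∩ {b ∉ C₁}`.

* `S0Event ends b a₁ o = {o ∈ S₀}`, `S₀` = the cluster of `a₁` in `G − b` (every edge at `b` closed:
  `delConfig ends {b}`); `deltaL0 = Δ_l⁰` (the `S₀`-world `Δ_l`, with `P(T, o ∈ S₀, b ∈ C₁) ≤ P(T, o ∈ C₁,
  b ∈ C₁)`); `LA0` = **(L_A⁰)** (stronger than `LA`), `LA0h` its heavy mirror.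
* `shareB = s_b = P(o ∈ C₁ | R_b)`, `shareDelta = s_Δ` (the `o`-share of the `T`-world order margin),
  `TpartPrime` = **(Tpart′)** `Δ_T (s_b − s_Δ) ≥ 0` (ratio form) and `TpartPrimeCleared` (product form).
* `WtD` = **(WtD)** `r_b · P(PD, b ∉ C₁) ≤ W · P(T, b ∉ C₁)` and its proof `WtD_of_order` under the
  labelling: with `X = P(T, b ∉ C₁)` and `R = PD ⊔ T` it reads `N_h · X ≥ r_b · P(R_b)`; in the light
  exploration `X = E[1_{b∉S}(1 − u); R]`, `P(R_b) = E[1_{b∉S}; R]`, `r_b = E[1_b(1 − u); R]` and the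
  chain is R10d (`E[1_b; R] ≤ N_h`) plus the single BHK 1.3 inequality `E[1_b; R]·E[u; R] ≤
  E[1_b u; R]·P(R)` (`bhk_step3`), which yields both the decreasing-pair and the mixed BHK steps.
-/

namespace Summit.Ventures.PercRepro2

open UnionCluster Yu1

section Companions

variable {V : Type*} {E : Type*} [Fintype E] [DecidableEq E] [Fintype V] [DecidableEq V]
  {R : Type*} [Field R] [LinearOrder R] [IsStrictOrderedRing R]

/-- `{o ∈ S₀}`: `o` lies in the cluster of `a₁` of `G − b` (all edges touching `b` closed). -/
noncomputable def S0Event (ends : E → Sym2 V) (b a₁ o : V) : Set (Config E) :=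
  {ω | o ∈ cluster ends (delConfig ends {b} ω) a₁}

/-- `Δ_l⁰ = P(T, o ∈ S₀, b ∈ C₁) − P(T, o ∈ C₁, b ∈ C₂)` (ADDENDUM 14 (1)). -/
noncomputable def deltaL0 (p : E → R) (ends : E → Sym2 V) (o a₁ a₂ a₃ b : V) : R :=
  prob p (TEvent ends a₁ a₂ a₃ ∩ S0Event ends b a₁ o ∩ connEvent ends a₁ b) -
    prob p (TEvent ends a₁ a₂ a₃ ∩ connEvent ends a₁ o ∩ connEvent ends a₂ b)

/-- `Δ_h⁰`: the heavy mirror of `Δ_l⁰` (`S₀^h` = the cluster of `a₂` in `G − b`). -/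
noncomputable def deltaH0 (p : E → R) (ends : E → Sym2 V) (o a₁ a₂ a₃ b : V) : R :=
  prob p (TEvent ends a₂ a₁ a₃ ∩ S0Event ends b a₂ o ∩ connEvent ends a₂ b) -
    prob p (TEvent ends a₂ a₁ a₃ ∩ connEvent ends a₂ o ∩ connEvent ends a₁ b)

/-- **(L_A⁰)** (ADDENDUM 14 (1)): `(T_{l→h} − Δ_l⁰) · P(PD, b ∉ C₁) ≤ P(PD, o ∈ C₁, b ∉ C₁) · W`;
stronger than `LA` since `Δ_l⁰ ≤ Δ_l`. -/
def LA0 (p : E → R) (ends : E → Sym2 V) (o a₁ a₂ a₃ b : V) : Prop :=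
  (prob p (PDEvent ends a₁ a₂ a₃ ∩ connEvent ends a₁ o ∩ connEvent ends a₂ b) -
      deltaL0 p ends o a₁ a₂ a₃ b) *
      prob p (PDEvent ends a₁ a₂ a₃ ∩ (connEvent ends a₁ b)ᶜ) ≤
    prob p (PDEvent ends a₁ a₂ a₃ ∩ connEvent ends a₁ o ∩ (connEvent ends a₁ b)ᶜ) *
      (massM2 p ends a₁ a₂ a₃ b + deltaT p ends a₁ a₂ a₃ b)

/-- **(L_A^h⁰)**: the heavy mirror of `LA0` (same `W`). -/
def LA0h (p : E → R) (ends : E → Sym2 V) (o a₁ a₂ a₃ b : V) : Prop :=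
  (prob p (PDEvent ends a₁ a₂ a₃ ∩ connEvent ends a₂ o ∩ connEvent ends a₁ b) -
      deltaH0 p ends o a₁ a₂ a₃ b) *
      prob p (PDEvent ends a₁ a₂ a₃ ∩ (connEvent ends a₂ b)ᶜ) ≤
    prob p (PDEvent ends a₁ a₂ a₃ ∩ connEvent ends a₂ o ∩ (connEvent ends a₂ b)ᶜ) *
      (massM2 p ends a₁ a₂ a₃ b + deltaT p ends a₁ a₂ a₃ b)

/-- `R_b = R ∩ {b ∉ C₁}`. -/
def RbEvent (ends : E → Sym2 V) (a₁ a₂ a₃ b : V) : Set (Config E) :=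
  avoidAll ends a₁ {a₂, a₃} ∩ (connEvent ends a₁ b)ᶜ

/-- `s_b = P(o ∈ C₁ | R_b)`. -/
noncomputable def shareB (p : E → R) (ends : E → Sym2 V) (o a₁ a₂ a₃ b : V) : R :=
  prob p (connEvent ends a₁ o ∩ RbEvent ends a₁ a₂ a₃ b) / prob p (RbEvent ends a₁ a₂ a₃ b)

/-- `s_Δ = [P(T, o ∈ C₁, b ∈ C₂) − P(T, o ∈ C₁, b ∈ C₁)] / Δ_T`: the `o`-share of the `T`-world
order margin. -/
noncomputable def shareDelta (p : E → R) (ends : E → Sym2 V) (o a₁ a₂ a₃ b : V) : R :=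
  (prob p (TEvent ends a₁ a₂ a₃ ∩ connEvent ends a₁ o ∩ connEvent ends a₂ b) -
      prob p (TEvent ends a₁ a₂ a₃ ∩ connEvent ends a₁ o ∩ connEvent ends a₁ b)) /
    deltaT p ends a₁ a₂ a₃ b

/-- **(Tpart′)** (ADDENDUM 14 (6)): `Δ_T · (s_b − s_Δ) ≥ 0` (ratio form, `x / 0 = 0`). -/
def TpartPrime (p : E → R) (ends : E → Sym2 V) (o a₁ a₂ a₃ b : V) : Prop :=
  0 ≤ deltaT p ends a₁ a₂ a₃ b * (shareB p ends o a₁ a₂ a₃ b - shareDelta p ends o a₁ a₂ a₃ b)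

/-- **(Tpart′), product form**: `[P(T, o ∈ C₁, b ∈ C₂) − P(T, o ∈ C₁, b ∈ C₁)] · P(R_b) ≤
Δ_T · P(o ∈ C₁, R_b)` (equivalent to `TpartPrime` when `Δ_T > 0` and `P(R_b) > 0`). -/
def TpartPrimeCleared (p : E → R) (ends : E → Sym2 V) (o a₁ a₂ a₃ b : V) : Prop :=
  (prob p (TEvent ends a₁ a₂ a₃ ∩ connEvent ends a₁ o ∩ connEvent ends a₂ b) -
      prob p (TEvent ends a₁ a₂ a₃ ∩ connEvent ends a₁ o ∩ connEvent ends a₁ b)) *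
      prob p (RbEvent ends a₁ a₂ a₃ b) ≤
    deltaT p ends a₁ a₂ a₃ b * prob p (connEvent ends a₁ o ∩ RbEvent ends a₁ a₂ a₃ b)

/-- **(WtD)** (ADDENDUM 14 (6)): `r_b · P(PD, b ∉ C₁) ≤ W · P(T, b ∉ C₁)`, `r_b = P(b ∈ C₁, T)`. -/
def WtD (p : E → R) (ends : E → Sym2 V) (a₁ a₂ a₃ b : V) : Prop :=
  prob p (connEvent ends a₁ b ∩ TEvent ends a₁ a₂ a₃) *
      prob p (PDEvent ends a₁ a₂ a₃ ∩ (connEvent ends a₁ b)ᶜ) ≤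
    (massM2 p ends a₁ a₂ a₃ b + deltaT p ends a₁ a₂ a₃ b) *
      prob p (TEvent ends a₁ a₂ a₃ ∩ (connEvent ends a₁ b)ᶜ)

omit [Fintype E] [DecidableEq E] [Fintype V] in
/-- `T` as a cluster event: `C₁ ∈ univ`, `C₂ ∈ {a₃ ∈ ·}`, `R`. -/
lemma T_event_eq (ends : E → Sym2 V) (a₁ a₂ a₃ : V) :
    clusterInEvent ends a₁ Set.univ ∩ clusterInEvent ends a₂ {W | a₃ ∈ W} ∩
        avoidAll ends a₁ {a₂, a₃} = TEvent ends a₁ a₂ a₃ := by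
  have h := rb_event_eq ends a₁ a₂ a₃ a₁
  ext ω
  have key := Set.ext_iff.1 h ω
  simp only [clusterInEvent, Set.mem_inter_iff, Set.mem_setOf_eq, Set.mem_univ, true_and,
    mem_cluster, mem_connEvent] at key ⊢
  have hself : Conn ends ω a₁ a₁ := conn_refl ends ω a₁
  tauto

omit [LinearOrder R] [IsStrictOrderedRing R] in
/-- Tower identity: `P(T) = E[1 − u(C₁); R]`. -/
lemma tower_T_only (p : E → R) (ends : E → Sym2 V) (a₁ a₂ a₃ : V) :
    prob p (TEvent ends a₁ a₂ a₃) =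
      expect p (fun ω => (1 - u p ends a₂ a₃ (cluster ends ω a₁)) *
        (avoidAll ends a₁ {a₂, a₃}).indicator 1 ω) := by
  rw [← T_event_eq, prob_clusterIn_inter_avoid_eq_expect p ends a₁ a₂ (X := {a₂, a₃})
    (Finset.mem_insert_self a₂ {a₃})]
  simp only [Set.indicator_univ, Pi.one_apply, one_mul, one_sub_u]

omit [Fintype V] [LinearOrder R] [IsStrictOrderedRing R] in
/-- `P(PD, b ∉ C₁) + P(T, b ∉ C₁) = P(R_b)`: split `R_b` along `a₃ ∈ C₂`. -/
lemma prob_PD_add_T_notb (p : E → R) (ends : E → Sym2 V) (a₁ a₂ a₃ b : V) :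
    prob p (PDEvent ends a₁ a₂ a₃ ∩ (connEvent ends a₁ b)ᶜ) +
        prob p (TEvent ends a₁ a₂ a₃ ∩ (connEvent ends a₁ b)ᶜ) =
      prob p (RbEvent ends a₁ a₂ a₃ b) := by
  have h := prob_inter_add_prob_inter_compl p (RbEvent ends a₁ a₂ a₃ b) (connEvent ends a₂ a₃)
  have e1 : RbEvent ends a₁ a₂ a₃ b ∩ connEvent ends a₂ a₃ =
      TEvent ends a₁ a₂ a₃ ∩ (connEvent ends a₁ b)ᶜ := by
    ext ω
    simp only [RbEvent, Set.mem_inter_iff, mem_connEvent, avoidAll, Finset.mem_insert,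
      Finset.mem_singleton, TEvent, Set.mem_setOf_eq, Set.mem_compl_iff]
    constructor
    · rintro ⟨⟨hR, hb⟩, h23⟩
      exact ⟨⟨fun h' => hR _ (Or.inl rfl) (conn_symm h'), h23⟩, hb⟩
    · rintro ⟨⟨h21, h23⟩, hb⟩
      refine ⟨⟨?_, hb⟩, h23⟩
      intro x hx
      rcases hx with rfl | rfl
      · exact fun h' => h21 (conn_symm h')
      · exact fun h' => h21 (conn_trans h23 (conn_symm h'))
  have e2 : RbEvent ends a₁ a₂ a₃ b ∩ (connEvent ends a₂ a₃)ᶜ =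
      PDEvent ends a₁ a₂ a₃ ∩ (connEvent ends a₁ b)ᶜ := by
    ext ω
    simp only [RbEvent, Set.mem_inter_iff, mem_connEvent, avoidAll, Finset.mem_insert,
      Finset.mem_singleton, PDEvent, Dtilde, inU, Set.mem_compl_iff, Set.mem_union]
    constructor
    · rintro ⟨⟨hR, hb⟩, h23⟩
      exact ⟨⟨hR _ (Or.inl rfl), fun h' => h'.elim (fun h' => hR _ (Or.inr rfl) (conn_symm h'))
        (fun h' => h23 (conn_symm h'))⟩, hb⟩
    · rintro ⟨⟨h12, h3⟩, hb⟩
      refine ⟨⟨?_, hb⟩, fun h' => h3 (Or.inr (conn_symm h'))⟩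
      intro x hx
      rcases hx with rfl | rfl
      · exact h12
      · exact fun h' => h3 (Or.inl (conn_symm h'))
  rw [e1, e2] at h
  rw [add_comm]
  exact h

omit [Fintype E] [DecidableEq E] [Fintype V] [DecidableEq V] in
/-- The polynomial core of (WtD): from `Bb ≤ B` and `Bb U ≤ BbU P`, with `r = Bb − BbU` and
`X = (P − U) − r ≥ 0`: `r · ((P − Bb) − X) · P ≤ (B − r) · X · P`. -/
lemma wtd_alg {B Bb BbU Uu PR : R} (h4 : Bb ≤ B) (h3 : Bb * Uu ≤ BbU * PR)
    (hX : 0 ≤ (PR - Uu) - (Bb - BbU)) (hPR : 0 ≤ PR) :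
    (Bb - BbU) * ((PR - Bb) - ((PR - Uu) - (Bb - BbU))) * PR ≤
      (B - (Bb - BbU)) * ((PR - Uu) - (Bb - BbU)) * PR := by
  have h1 : 0 ≤ (B - Bb) * ((PR - Uu) - (Bb - BbU)) * PR :=
    mul_nonneg (mul_nonneg (sub_nonneg.2 h4) hX) hPR
  have h2 : 0 ≤ PR * (BbU * PR - Bb * Uu) := mul_nonneg hPR (sub_nonneg.2 h3)
  have e : (B - (Bb - BbU)) * ((PR - Uu) - (Bb - BbU)) * PR -
      (Bb - BbU) * ((PR - Bb) - ((PR - Uu) - (Bb - BbU))) * PR =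
      (B - Bb) * ((PR - Uu) - (Bb - BbU)) * PR + PR * (BbU * PR - Bb * Uu) := by ring
  linarith [e, h1, h2]

/-- **(WtD) is a theorem** under the labelling `P(b ↔ a₁) ≤ P(b ↔ a₂)` (ADDENDUM 14 (6); the
three-step proof of mine-2's 21:14Z note, both BHK steps being `bhk_step3`). -/
theorem WtD_of_order (p : E → R) (hp : IsProbVec p) (ends : E → Sym2 V) {a₁ a₂ a₃ b : V}
    (hord : prob p (connEvent ends a₁ b) ≤ prob p (connEvent ends a₂ b)) :
    WtD p ends a₁ a₂ a₃ b := by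
  unfold WtD
  -- the atoms: `Bb = E[1_b; R]`, `BbU = E[1_b u; R]`, `Uu = E[u; R]`, `B = E[β; R]`, `PR = P(R)`
  have hind : ∀ ω, 0 ≤ (avoidAll ends a₁ {a₂, a₃}).indicator (1 : Config E → R) ω :=
    fun _ => Set.indicator_apply_nonneg fun _ => zero_le_one
  have s4 := order_on_R p hp ends (a₃ := a₃) hord
  rw [tower_b, tower_N] at s4
  have h3 := bhk_step3 p hp ends a₁ a₂ a₃ b
  have eRb : expect p (fun ω => ind b (cluster ends ω a₁) *
      (1 - u p ends a₂ a₃ (cluster ends ω a₁)) * (avoidAll ends a₁ {a₂, a₃}).indicator 1 ω) =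
      expect p (fun ω => ind b (cluster ends ω a₁) * (avoidAll ends a₁ {a₂, a₃}).indicator 1 ω) -
      expect p (fun ω => ind b (cluster ends ω a₁) * u p ends a₂ a₃ (cluster ends ω a₁) *
        (avoidAll ends a₁ {a₂, a₃}).indicator 1 ω) := by
    rw [← expect_sub]
    congr 1
    funext ω
    simp only [Pi.sub_apply]
    ring
  have eT : expect p (fun ω => (1 - u p ends a₂ a₃ (cluster ends ω a₁)) *
      (avoidAll ends a₁ {a₂, a₃}).indicator 1 ω) =
      prob p (avoidAll ends a₁ {a₂, a₃}) -
        expect p (fun ω => u p ends a₂ a₃ (cluster ends ω a₁) *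
          (avoidAll ends a₁ {a₂, a₃}).indicator 1 ω) := by
    rw [prob_eq_expect_indicator, ← expect_sub]
    congr 1
    funext ω
    simp only [Pi.sub_apply]
    ring
  -- the plain-event quantities in tower form
  have hRb : prob p (RbEvent ends a₁ a₂ a₃ b) = prob p (avoidAll ends a₁ {a₂, a₃}) -
      expect p (fun ω => ind b (cluster ends ω a₁) * (avoidAll ends a₁ {a₂, a₃}).indicator 1 ω) := by
    have h := prob_inter_add_prob_inter_compl p (avoidAll ends a₁ {a₂, a₃}) (connEvent ends a₁ b)
    rw [Set.inter_comm, tower_b] at h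
    unfold RbEvent
    linarith
  have hX : prob p (TEvent ends a₁ a₂ a₃ ∩ (connEvent ends a₁ b)ᶜ) =
      prob p (TEvent ends a₁ a₂ a₃) - prob p (connEvent ends a₁ b ∩ TEvent ends a₁ a₂ a₃) := by
    have h := prob_inter_add_prob_inter_compl p (TEvent ends a₁ a₂ a₃) (connEvent ends a₁ b)
    rw [Set.inter_comm] at h
    linarith
  have hPDb := prob_PD_add_T_notb p ends a₁ a₂ a₃ b
  have hW := W_eq p ends a₁ a₂ a₃ b
  rw [hW]
  rw [hRb, hX] at hPDb
  rw [hX, tower_T_only, eT, tower_r, eRb]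
  rw [tower_T_only, eT, tower_r, eRb] at hPDb
  have hX0 : 0 ≤ prob p (TEvent ends a₁ a₂ a₃ ∩ (connEvent ends a₁ b)ᶜ) := prob_nonneg hp _
  rw [hX, tower_T_only, eT, tower_r, eRb] at hX0
  have hPR : 0 ≤ prob p (avoidAll ends a₁ {a₂, a₃}) := prob_nonneg hp _
  have key := wtd_alg s4 h3 hX0 hPR
  -- `P(PD, b ∉ C₁) = P(R_b) − X`
  have hPD' : prob p (PDEvent ends a₁ a₂ a₃ ∩ (connEvent ends a₁ b)ᶜ) =
      (prob p (avoidAll ends a₁ {a₂, a₃}) -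
        expect p (fun ω => ind b (cluster ends ω a₁) * (avoidAll ends a₁ {a₂, a₃}).indicator 1 ω)) -
      (prob p (avoidAll ends a₁ {a₂, a₃}) -
          expect p (fun ω => u p ends a₂ a₃ (cluster ends ω a₁) *
            (avoidAll ends a₁ {a₂, a₃}).indicator 1 ω) -
        (expect p (fun ω => ind b (cluster ends ω a₁) *
            (avoidAll ends a₁ {a₂, a₃}).indicator 1 ω) -
          expect p (fun ω => ind b (cluster ends ω a₁) * u p ends a₂ a₃ (cluster ends ω a₁) *
            (avoidAll ends a₁ {a₂, a₃}).indicator 1 ω))) := by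
    linarith
  rw [hPD']
  rcases hPR.lt_or_eq with hpos | hzero
  · exact le_of_mul_le_mul_right key hpos
  · have hz : ∀ g : Config E → R,
        expect p (fun ω => g ω * (avoidAll ends a₁ {a₂, a₃}).indicator 1 ω) = 0 :=
      fun g => expect_mul_indicator_eq_zero_of_null hp hzero.symm g
    simp [hz, ← hzero]

end Companions

end Summit.Ventures.PercRepro2
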